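import Literature.Analysis.FluidPDE.Ferrari1993ContinuationLeaves
import Literature.Analysis.FluidPDE.ShirotaYanagisawaLogDivCurlHolds
import HarnessLib

/-!
# Discharge of `Ferrari1993_periodicCylinderH3Bound`; the continuation on its last leaf

Topic `Literature/Analysis/FluidPDE`. Proof file (theorems only, no definition, no named fact).

The a-priori `H³` bound of A. B. Ferrari, *On the blow-up of solutions of the 3-D Euler equations
in a bounded domain*, Comm. Math. Phys. **155** (1993) 277–294, §1, proof of Thm 2, (4) ⇒ (7) =
(17) (pp. 279–282) — the named fact
`Literature.Analysis.FluidPDE.Ferrari1993_periodicCylinderH3Bound` (`Ferrari1993Continuation.lean`):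
a solution of the smooth `L`-periodic class in the cylinder `{r < 1}` on `[0, T)` whose vorticity is
bounded on `[0, T) × {r < 1}` has `sup_{[0,T)} ‖u(t)‖_{H³(cell)} < ∞` — is **proved**:
`Ferrari1993_periodicCylinderH3Bound_holds`. It is the term
`Ferrari1993_periodicCylinderH3Bound_of_logDivCurl` (`Ferrari1993ContinuationLeaves.lean`: the
`D^α`-energy method (8)–(14) with Lemma 1 ii) and Lemma 2, the Gronwall step (15)–(17),
conservation of energy, all proved in the tree) fed with the discharge
`ShirotaYanagisawa1993_periodicCylinderLogDivCurlEstimate_holds`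
(`ShirotaYanagisawaLogDivCurlHolds.lean`) of the stationary logarithmic div–curl estimate, which
landed after that assembly file; the two files are joined here (neither may import the other's
dependencies without lengthening the build chain of the pressure files).

Consequently the continuation fact `Ferrari1993_periodicCylinderContinuation`
(`ChenHouContinuationProofs.lean`; Ferrari's Thm 2 in contrapositive, continuation form), the BKM
criterion in the periodic cylinder `Ferrari1993_periodicCylinderEulerBKM` and — given Chen–Hou's
own a-priori estimates — the Chen–Hou blow-up `chen_hou_blowup` rest on **one** named fact of the
Kato–Lai/Ferrari theory, the uniform-time local existence
`KatoLai1984_periodicCylinderUniformExistence` (Kato–Lai 1984, Thms I–II p. 17 = Ferrari's Thm 1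
p. 279): `Ferrari1993_periodicCylinderContinuation_of_uniformExistence`,
`Ferrari1993_periodicCylinderEulerBKM_of_uniformExistence`, `chen_hou_blowup_of_uniformExistence`.
The discharge `Ferrari1993_periodicCylinderContinuation_holds` is the first of these applied to
`KatoLai1984_periodicCylinderUniformExistence_holds` once that fact is proved.
-/

noncomputable section

namespace Literature.Analysis.FluidPDE

/-- **Ferrari's a-priori `H³` bound holds** (`Ferrari1993_periodicCylinderH3Bound`): bounded
vorticity on `[0, T) × {r < 1}` bounds `‖u(t)‖_{H³(cell)}` uniformly on `[0, T)` for solutions of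
the smooth periodic class. [cite: Ferrari1993, §1 proof of Thm 2, (4) ⇒ (7) = (17) (pp. 279–282)] -/
theorem Ferrari1993_periodicCylinderH3Bound_holds : Ferrari1993_periodicCylinderH3Bound :=
  Ferrari1993_periodicCylinderH3Bound_of_logDivCurl
    ShirotaYanagisawa1993_periodicCylinderLogDivCurlEstimate_holds

/-- **Continuation past a time of bounded vorticity from Kato–Lai's uniform-time existence
alone** (`Ferrari1993_periodicCylinderContinuation` on its last leaf). [cite: Ferrari1993, Thm 2 (p. 279) and its proof pp. 279–283] -/
theorem Ferrari1993_periodicCylinderContinuation_of_uniformExistence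
    (hE : KatoLai1984_periodicCylinderUniformExistence) :
    Ferrari1993_periodicCylinderContinuation :=
  Ferrari1993_periodicCylinderContinuation_of_H3Bound_of_uniformExistence
    Ferrari1993_periodicCylinderH3Bound_holds hE

/-- **The BKM criterion in the periodic cylinder from Kato–Lai's uniform-time existence alone.**
[cite: Ferrari1993, Thms 1–2 (p. 279)] -/
theorem Ferrari1993_periodicCylinderEulerBKM_of_uniformExistence
    (hE : KatoLai1984_periodicCylinderUniformExistence) : Ferrari1993_periodicCylinderEulerBKM :=
  Ferrari1993_periodicCylinderEulerBKM_of_H3Bound_of_uniformExistence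
    Ferrari1993_periodicCylinderH3Bound_holds hE

/-- **The Chen–Hou blow-up on two named facts**: Kato–Lai's uniform-time existence and Chen–Hou's
a-priori blow-up estimates. [cite: arXiv221007191, §1 Theorem 2 (p. 3) and §6.1 Theorem 4 (p. 54)] -/
theorem chen_hou_blowup_of_uniformExistence
    (hE : KatoLai1984_periodicCylinderUniformExistence)
    (hCH : ChenHou2022_aprioriBlowupEstimates) : chen_hou_blowup :=
  chen_hou_blowup_of_H3Bound_of_uniformExistence Ferrari1993_periodicCylinderH3Bound_holds hE hCH

end Literature.Analysis.FluidPDE
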